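import Summits.AtomisticToContinuum.HydrodynamicLimit.Theorems.JaynesSqueezeLocalGibbsConcentrationDiluteInversion

/-!
# The tilted density of the dilute hard-sphere gas (inversion of the activity under tilts)

Helper file for item `LocalGibbsConcentrationDilute` (stmt-AtomisticToContinuum-13460) of route
`JaynesSqueeze`; companion of `JaynesSqueezeLocalGibbsConcentrationDiluteInversion`.

* `exists_tilted_density` (**the inversion under tilts**) — under `HsEosLowDensity` there is
  `η₂ > 0` such that for `σ > 0`, a continuous normalised density `ρ₁ ≥ 0` with `ρ₁σ³ ≤ η₂`, a
  continuous `χ` and `ε > 0` there is `t₀ > 0` such that for `|t| ≤ t₀` the tilted activity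
  `ρ₁ e^{g_σ(ρ₁)} e^{tχ}` is, up to a positive constant `κ`, the activity `ρ e^{g_σ(ρ)}` of a
  continuous normalised density `ρ ≥ 0` with `|ρ - ρ₁| ≤ ε` (`g_σ(r) = f_ex(rσ³) + rσ³ f_ex'(rσ³)`;
  intermediate value theorem for the normalising constant, uniform continuity of `Λ⁻¹`).

No definitions (pure-proof helper file). prover-pitem-stmt-AtomisticToContinuum-13460-0.
-/

noncomputable section

namespace Summit.AtomisticToContinuum.HydrodynamicLimit.Theorems

open MeasureTheory Filter Topology Set
open Literature.Analysis.FluidPDE Literature.MathematicalPhysics.KineticTheory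
open Summit.AtomisticToContinuum.HydrodynamicLimit.Theses.JaynesSqueeze

namespace LocalGibbsConcentration

section Tilt

/-- `|y - 1| ≤ eˢ - 1` for `y ∈ [e^{-s}, eˢ]`. [folklore] -/
theorem abs_sub_one_le_of_mem_Icc_exp {s y : ℝ}
    (hy : y ∈ Icc (Real.exp (-s)) (Real.exp s)) : |y - 1| ≤ Real.exp s - 1 := by
  have h1 : Real.exp (-s) + Real.exp s ≥ 2 := by
    have := Real.add_one_le_exp s
    have := Real.add_one_le_exp (-s)
    nlinarith [Real.exp_pos s, Real.exp_pos (-s), Real.exp_neg s,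
      mul_pos (Real.exp_pos s) (Real.exp_pos (-s)), sq_nonneg (Real.exp s - 1),
      show Real.exp s * Real.exp (-s) = 1 by rw [← Real.exp_add, add_neg_cancel, Real.exp_zero]]
  rw [abs_le]
  constructor <;> linarith [hy.1, hy.2]

/-- **Inversion of the activity–density relation under tilts.** Under `HsEosLowDensity` there is
`η₂ > 0` such that for every `σ > 0`, every continuous normalised density `ρ₁ ≥ 0` with
`ρ₁ σ³ ≤ η₂`, every continuous `χ` and `ε > 0` there is `t₀ > 0` with: for `|t| ≤ t₀` the tilted
activity `ρ₁ e^{g_σ(ρ₁)} e^{tχ}` equals `κ⁻¹ ρ e^{g_σ(ρ)}` for a constant `κ > 0` and a continuous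
normalised density `ρ ≥ 0` with `|ρ - ρ₁| ≤ ε` (here
`g_σ(r) = f_ex(rσ³) + rσ³ f_ex'(rσ³)`, `f_ex = hsExcessFreeEnergy`). The normalising constant is
found by the intermediate value theorem; `ρ σ³ = Λ⁻¹(κ Λ(ρ₁σ³) e^{tχ})`. [folklore] -/
theorem exists_tilted_density (hEos : HsEosLowDensity) :
    ∃ η₂ : ℝ, 0 < η₂ ∧ ∀ σ : ℝ, 0 < σ → ∀ ρ₁ : T3 → ℝ, Continuous ρ₁ → (∀ x, 0 ≤ ρ₁ x) →
      (∀ x, ρ₁ x * σ ^ 3 ≤ η₂) → ∫ x, ρ₁ x = 1 → ∀ χ : T3 → ℝ, Continuous χ → ∀ ε : ℝ, 0 < ε →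
      ∃ t₀ : ℝ, 0 < t₀ ∧ ∀ t : ℝ, |t| ≤ t₀ → ∃ (κ : ℝ) (ρ : T3 → ℝ), 0 < κ ∧ Continuous ρ ∧
        (∀ x, 0 ≤ ρ x) ∧ (∀ x, |ρ x - ρ₁ x| ≤ ε) ∧ ∫ x, ρ x = 1 ∧
        ∀ x, ρ x * Real.exp (hsExcessFreeEnergy (ρ x * σ ^ 3) +
            ρ x * σ ^ 3 * deriv hsExcessFreeEnergy (ρ x * σ ^ 3)) =
          κ * (ρ₁ x * Real.exp (hsExcessFreeEnergy (ρ₁ x * σ ^ 3) +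
            ρ₁ x * σ ^ 3 * deriv hsExcessFreeEnergy (ρ₁ x * σ ^ 3))) * Real.exp (t * χ x) := by
  obtain ⟨η₃, hη₃, hΛcont, hΛmono⟩ := exists_strictMonoOn_activity hEos
  set Λ : ℝ → ℝ := fun η => η * Real.exp (hsExcessFreeEnergy η +
    η * deriv hsExcessFreeEnergy η) with hΛ
  have hΛ0 : Λ 0 = 0 := by simp [hΛ]
  obtain ⟨Λinv, hinv_cont, hinv_mono, hinv_mem, hinv_left, hinv_right⟩ :=
    exists_continuous_inverse hη₃.le hΛcont hΛmono hΛ0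
  have hΛmonoOn : MonotoneOn Λ (Icc 0 η₃) := hΛmono.monotoneOn
  have hΛnn : ∀ η ∈ Icc 0 η₃, 0 ≤ Λ η := fun η hη => hΛ0 ▸ hΛmonoOn ⟨le_rfl, hη₃.le⟩ hη hη.1
  refine ⟨η₃ / 2, by positivity, ?_⟩
  intro σ hσ ρ₁ hρ₁c hρ₁0 hband hnorm χ hχ ε hε
  have hσ3 : 0 < σ ^ 3 := by positivity
  obtain ⟨K, hK0, hK⟩ := exists_forall_abs_le_of_continuous hχ
  set M : ℝ := Λ η₃ with hM
  set M₁ : ℝ := Λ (η₃ / 2) with hM₁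
  have hη3mem : η₃ ∈ Icc 0 η₃ := ⟨hη₃.le, le_rfl⟩
  have hη32mem : η₃ / 2 ∈ Icc 0 η₃ := ⟨by positivity, by linarith⟩
  have hM₁M : M₁ < M := hΛmono hη32mem hη3mem (by linarith)
  have hM₁0 : 0 ≤ M₁ := hΛnn _ hη32mem
  have hM0 : 0 < M := lt_of_le_of_lt hM₁0 hM₁M
  -- the data profile in reduced units
  have hρmem : ∀ x, ρ₁ x * σ ^ 3 ∈ Icc 0 η₃ := fun x =>
    ⟨mul_nonneg (hρ₁0 x) hσ3.le, (hband x).trans (by linarith)⟩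
  have hΛρ_le : ∀ x, Λ (ρ₁ x * σ ^ 3) ≤ M₁ := fun x =>
    hΛmonoOn (hρmem x) hη32mem (hband x)
  have hΛρ_nn : ∀ x, 0 ≤ Λ (ρ₁ x * σ ^ 3) := fun x => hΛnn _ (hρmem x)
  have hΛρ_cont : Continuous fun x => Λ (ρ₁ x * σ ^ 3) :=
    hΛcont.comp_continuous (hρ₁c.mul continuous_const) hρmem
  -- uniform continuity of `Λinv` on `[0, M]`
  obtain ⟨δu, hδu, hunif⟩ : ∃ δu > 0, ∀ y ∈ Icc 0 M, ∀ y' ∈ Icc 0 M, |y - y'| < δu →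
      |Λinv y - Λinv y'| < ε * σ ^ 3 := by
    have hu := (isCompact_Icc (a := (0 : ℝ)) (b := M)).uniformContinuousOn_of_continuous
      hinv_cont.continuousOn
    rw [Metric.uniformContinuousOn_iff] at hu
    obtain ⟨δu, hδu, h⟩ := hu (ε * σ ^ 3) (by positivity)
    exact ⟨δu, hδu, fun y hy y' hy' hyy' => by
      have := h y hy y' hy' (by rwa [Real.dist_eq])
      rwa [Real.dist_eq] at this⟩
  -- smallness of the tilt: `e^{s} - 1` small and `M₁ eˢ ≤ M` for `|s| ≤ s₀`
  obtain ⟨s₀, hs₀, hsmall⟩ : ∃ s₀ > 0, ∀ s : ℝ, |s| ≤ s₀ →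
      M * (Real.exp s - 1) < δu ∧ M₁ * Real.exp s ≤ M := by
    have hc : ContinuousAt Real.exp 0 := Real.continuous_exp.continuousAt
    rw [Metric.continuousAt_iff] at hc
    set e₀ : ℝ := min (δu / (M + 1)) ((M - M₁) / (M₁ + 1)) with he₀
    have he₀pos : 0 < e₀ := lt_min (by positivity) (div_pos (by linarith) (by linarith))
    obtain ⟨s₁, hs₁, h⟩ := hc e₀ he₀pos
    refine ⟨s₁ / 2, by positivity, fun s hs => ?_⟩
    have hds : dist s 0 < s₁ := by rw [Real.dist_eq, sub_zero]; linarith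
    have h1 := h hds
    rw [Real.exp_zero, Real.dist_eq] at h1
    have h2 : Real.exp s - 1 < e₀ := lt_of_le_of_lt (le_abs_self _) h1
    have h3 : e₀ ≤ δu / (M + 1) := min_le_left _ _
    have h4 : e₀ ≤ (M - M₁) / (M₁ + 1) := min_le_right _ _
    constructor
    · calc M * (Real.exp s - 1) ≤ M * e₀ := mul_le_mul_of_nonneg_left h2.le hM0.le
        _ ≤ M * (δu / (M + 1)) := mul_le_mul_of_nonneg_left h3 hM0.le
        _ < δu := by
            rw [mul_div_assoc', div_lt_iff₀ (by linarith)]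
            nlinarith
    · have h5 : Real.exp s ≤ 1 + e₀ := by linarith
      calc M₁ * Real.exp s ≤ M₁ * (1 + e₀) := mul_le_mul_of_nonneg_left h5 hM₁0
        _ ≤ M₁ * (1 + (M - M₁) / (M₁ + 1)) := by gcongr
        _ ≤ M := by
            rw [mul_add, mul_div_assoc']
            have : M₁ * (M - M₁) / (M₁ + 1) ≤ M - M₁ := by
              rw [div_le_iff₀ (by linarith)]
              nlinarith
            linarith
  -- the tilt radius
  set t₀ : ℝ := s₀ / (2 * (K + 1)) with ht₀
  have ht₀pos : 0 < t₀ := by positivity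
  refine ⟨t₀, ht₀pos, fun t ht => ?_⟩
  -- `s = 2|t|K ≤ s₀`
  set s : ℝ := 2 * |t| * K with hs_def
  have hs0 : 0 ≤ s := by positivity
  have hs_le : s ≤ s₀ := by
    calc s = 2 * |t| * K := rfl
      _ ≤ 2 * t₀ * K := by gcongr
      _ = s₀ * (K / (K + 1)) := by rw [ht₀]; field_simp
      _ ≤ s₀ * 1 := mul_le_mul_of_nonneg_left
          ((div_le_one (by linarith)).2 (by linarith)) hs₀.le
      _ = s₀ := mul_one _
  obtain ⟨hsmall1, hsmall2⟩ := hsmall s (by rwa [abs_of_nonneg hs0])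
  have htχ : ∀ x, |t * χ x| ≤ |t| * K := fun x => by
    rw [abs_mul]; exact mul_le_mul_of_nonneg_left (hK x) (abs_nonneg t)
  -- the tilted activity in reduced units and the range of `κ e^{tχ}`
  set b : T3 → ℝ := fun x => Λ (ρ₁ x * σ ^ 3) * Real.exp (t * χ x) with hb
  have hb_cont : Continuous b := hΛρ_cont.mul (by fun_prop)
  have hκe : ∀ κ ∈ Icc (Real.exp (-(|t| * K))) (Real.exp (|t| * K)), ∀ x,
      κ * Real.exp (t * χ x) ∈ Icc (Real.exp (-s)) (Real.exp s) := by
    intro κ hκ x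
    have h1 := abs_le.1 (htχ x)
    constructor
    · calc Real.exp (-s) = Real.exp (-(|t| * K)) * Real.exp (-(|t| * K)) := by
            rw [← Real.exp_add]; congr 1; rw [hs_def]; ring
        _ ≤ κ * Real.exp (t * χ x) :=
            mul_le_mul hκ.1 (Real.exp_le_exp.2 (by linarith)) (Real.exp_pos _).le
              ((Real.exp_pos _).le.trans hκ.1)
    · calc κ * Real.exp (t * χ x) ≤ Real.exp (|t| * K) * Real.exp (|t| * K) :=
            mul_le_mul hκ.2 (Real.exp_le_exp.2 h1.2) (Real.exp_pos _).le (Real.exp_pos _).le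
        _ = Real.exp s := by rw [← Real.exp_add]; congr 1; rw [hs_def]; ring
  have hκb_mem : ∀ κ ∈ Icc (Real.exp (-(|t| * K))) (Real.exp (|t| * K)), ∀ x,
      κ * b x ∈ Icc 0 M := by
    intro κ hκ x
    have hκ0 : 0 ≤ κ := (Real.exp_pos _).le.trans hκ.1
    refine ⟨mul_nonneg hκ0 (mul_nonneg (hΛρ_nn x) (Real.exp_pos _).le), ?_⟩
    calc κ * b x = Λ (ρ₁ x * σ ^ 3) * (κ * Real.exp (t * χ x)) := by rw [hb]; ring
      _ ≤ M₁ * Real.exp s := mul_le_mul (hΛρ_le x) (hκe κ hκ x).2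
          (mul_nonneg hκ0 (Real.exp_pos _).le) hM₁0
      _ ≤ M := hsmall2
  -- the normalisation map `Φ κ = ∫ Λinv (κ b)` is continuous
  set Φ : ℝ → ℝ := fun κ => ∫ x, Λinv (κ * b x) with hΦ
  have hΦcont : Continuous Φ := by
    refine continuous_of_dominated (F := fun κ x => Λinv (κ * b x)) (bound := fun _ => η₃)
      (fun κ => ?_) (fun κ => Eventually.of_forall fun x => ?_) (integrable_const η₃)
      (Eventually.of_forall fun x => ?_)
    · exact (hinv_cont.comp (continuous_const.mul hb_cont)).aestronglyMeasurable
    · rw [Real.norm_eq_abs, abs_of_nonneg (hinv_mem _).1]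
      exact (hinv_mem _).2
    · exact hinv_cont.comp (continuous_id.mul continuous_const)
  -- values at the endpoints
  have hinvρ : ∀ x, Λinv (Λ (ρ₁ x * σ ^ 3)) = ρ₁ x * σ ^ 3 := fun x => hinv_left _ (hρmem x)
  have hint_ρσ : ∫ x, ρ₁ x * σ ^ 3 = σ ^ 3 := by rw [integral_mul_const, hnorm, one_mul]
  have hΦlow : Φ (Real.exp (-(|t| * K))) ≤ σ ^ 3 := by
    rw [hΦ, ← hint_ρσ]
    refine integral_mono_of_nonneg (Eventually.of_forall fun x => (hinv_mem _).1)
      (integrable_of_continuous_T3 (hρ₁c.mul continuous_const)) (Eventually.of_forall fun x => ?_)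
    show Λinv (Real.exp (-(|t| * K)) * b x) ≤ ρ₁ x * σ ^ 3
    rw [← hinvρ x]
    refine hinv_mono ?_
    calc Real.exp (-(|t| * K)) * b x
        = Λ (ρ₁ x * σ ^ 3) * Real.exp (-(|t| * K) + t * χ x) := by rw [hb, Real.exp_add]; ring
      _ ≤ Λ (ρ₁ x * σ ^ 3) * 1 := by
          refine mul_le_mul_of_nonneg_left ?_ (hΛρ_nn x)
          rw [← Real.exp_zero, Real.exp_le_exp]
          linarith [(abs_le.1 (htχ x)).2]
      _ = Λ (ρ₁ x * σ ^ 3) := mul_one _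
  have hΦhigh : σ ^ 3 ≤ Φ (Real.exp (|t| * K)) := by
    rw [hΦ, ← hint_ρσ]
    refine integral_mono (integrable_of_continuous_T3 (hρ₁c.mul continuous_const))
      ((integrable_const η₃).mono' (hinv_cont.comp (continuous_const.mul hb_cont)).aestronglyMeasurable
        (Eventually.of_forall fun x => by
          rw [Real.norm_eq_abs, abs_of_nonneg (hinv_mem _).1]; exact (hinv_mem _).2))
      fun x => ?_
    show ρ₁ x * σ ^ 3 ≤ Λinv (Real.exp (|t| * K) * b x)
    rw [← hinvρ x]
    refine hinv_mono ?_
    calc Λ (ρ₁ x * σ ^ 3) = Λ (ρ₁ x * σ ^ 3) * 1 := (mul_one _).symm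
      _ ≤ Λ (ρ₁ x * σ ^ 3) * Real.exp (|t| * K + t * χ x) := by
          refine mul_le_mul_of_nonneg_left ?_ (hΛρ_nn x)
          rw [← Real.exp_zero, Real.exp_le_exp]
          linarith [(abs_le.1 (htχ x)).1]
      _ = Real.exp (|t| * K) * b x := by rw [hb, Real.exp_add]; ring
  -- intermediate value theorem for the normalising constant
  have hab : Real.exp (-(|t| * K)) ≤ Real.exp (|t| * K) := Real.exp_le_exp.2 (by
    linarith [mul_nonneg (abs_nonneg t) hK0])
  obtain ⟨κ, hκmem, hκ⟩ := intermediate_value_Icc hab hΦcont.continuousOn ⟨hΦlow, hΦhigh⟩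
  have hκpos : 0 < κ := (Real.exp_pos _).trans_le hκmem.1
  -- the tilted density
  set ρ : T3 → ℝ := fun x => Λinv (κ * b x) / σ ^ 3 with hρ
  have hρσ : ∀ x, ρ x * σ ^ 3 = Λinv (κ * b x) := fun x => div_mul_cancel₀ _ hσ3.ne'
  refine ⟨κ, ρ, hκpos, (hinv_cont.comp (continuous_const.mul hb_cont)).div_const _,
    fun x => div_nonneg (hinv_mem _).1 hσ3.le, fun x => ?_, ?_, fun x => ?_⟩
  · -- closeness to `ρ₁`
    have hclose : |Λinv (κ * b x) - Λinv (Λ (ρ₁ x * σ ^ 3))| < ε * σ ^ 3 := by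
      refine hunif _ (hκb_mem κ hκmem x) _ ⟨hΛρ_nn x, (hΛρ_le x).trans hM₁M.le⟩ ?_
      calc |κ * b x - Λ (ρ₁ x * σ ^ 3)|
          = Λ (ρ₁ x * σ ^ 3) * |κ * Real.exp (t * χ x) - 1| := by
            rw [hb, show κ * (Λ (ρ₁ x * σ ^ 3) * Real.exp (t * χ x)) - Λ (ρ₁ x * σ ^ 3) =
              Λ (ρ₁ x * σ ^ 3) * (κ * Real.exp (t * χ x) - 1) by ring, abs_mul,
              abs_of_nonneg (hΛρ_nn x)]
        _ ≤ M * (Real.exp s - 1) :=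
            mul_le_mul ((hΛρ_le x).trans hM₁M.le)
              (abs_sub_one_le_of_mem_Icc_exp (hκe κ hκmem x)) (abs_nonneg _) hM0.le
        _ < δu := hsmall1
    rw [hinvρ x] at hclose
    have : |ρ x - ρ₁ x| * σ ^ 3 ≤ ε * σ ^ 3 := by
      rw [← abs_of_pos hσ3, ← abs_mul, sub_mul, hρσ x, abs_of_pos hσ3]
      exact hclose.le
    exact le_of_mul_le_mul_right this hσ3
  · -- normalisation
    show ∫ x, Λinv (κ * b x) / σ ^ 3 = 1
    rw [integral_div, show (∫ x, Λinv (κ * b x)) = Φ κ from rfl, hκ, div_self hσ3.ne']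
  · -- the activity identity: `Λ(ρ σ³) = κ b`
    have hid : Λ (ρ x * σ ^ 3) = κ * b x := by
      rw [hρσ x]
      exact hinv_right _ (hκb_mem κ hκmem x)
    simp only [hΛ, hb] at hid
    have hid' : ρ x * σ ^ 3 * Real.exp (hsExcessFreeEnergy (ρ x * σ ^ 3) +
        ρ x * σ ^ 3 * deriv hsExcessFreeEnergy (ρ x * σ ^ 3)) =
        κ * (ρ₁ x * σ ^ 3 * Real.exp (hsExcessFreeEnergy (ρ₁ x * σ ^ 3) +
        ρ₁ x * σ ^ 3 * deriv hsExcessFreeEnergy (ρ₁ x * σ ^ 3)) * Real.exp (t * χ x)) := hid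
    apply mul_right_cancel₀ hσ3.ne'
    linear_combination hid'

end Tilt

end LocalGibbsConcentration

end Summit.AtomisticToContinuum.HydrodynamicLimit.Theorems
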